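import Mathlib
import Summits.ValiantsHypothesis.ValiantsHypothesis.Theorems.BarrierLeverPartitionMinorsHitByVPHiddenStatesTripleRank
import Summits.ValiantsHypothesis.ValiantsHypothesis.Theorems.BarrierLeverPartitionMinorsHitByVPHiddenStatesBall

/-!
# Route BarrierLever — item `PartitionMinorsHitByVP` (stmt-ValiantsHypothesis-19717):
# THE 2-SKELETON OBSTRUCTION — the single-cube Conjecture Q\*(h²) is FALSE (parametric kernel negative)

Helper file (`--supports stmt-ValiantsHypothesis-19717`; cell valiant-natproofs, rung V4, 𝒟-side door (c), line
`hidden-states`; prover seat val-np-p3 gen 9). Closes NO item; two bookkeeping `def`s (`lowStates`, `tripleU`).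

RESULT (`not_ballGood_sq_hypothesis`):
  `¬ ∃ h₁, ∀ h ≥ h₁, ∀ r (u : Fin r → Finset (Fin h)), Injective u → BallGood h (h·h) r u`
— the hypothesis of the landed door `HiddenStates.partitionMinorsHitByVP_of_ballGood'` instantiated at its maximal state
count `Kf h = h·h` is unsatisfiable. WITNESS (`not_ballGood_triples`): for every `h = 8m`, `m ≥ 5`, the family of ALL
TRIPLES of `Fin h` (`r = C(h,3)` rows, the 2-skeleton of the simplex) against the ball–colex family `𝔅(h², C(h,3))`.
MECHANISM (the triple-row rank bound of `…HiddenStatesTripleRank`, = val-np-p3 g8's family-top concentration made exact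
by the two-layer core reduction of the g9 memo §9–§10): `𝔅(h², r)` is two-layer (members of size `≤ 2`,
`card_le_two_of_threshold`) with its `c = r − 1 − h²` pairs inside the first `8m² = h²/8` states
(`pair_subset_lowStates_of_threshold`, binary order), so the `r` rows of size `3` span at most `(h²+1) + (h²/8)·h`
dimensions — fewer than `r = C(h,3)` once `m ≥ 5` — and the additive matrix is singular for EVERY table.

CENSUS MATCH (kit j289637/j289638, HOME/val-np-p3/g9/kscan): the skeleton `B₃([h])` is BAD exactly on the window
`[h + 1 + ⌊(1+√(1+8h))/2⌋, |B₃(h)| − 1 − c*(h)]` (h = 8: [13,15]; h = 9: [14,38]; h = 10: [16,59]) predicted by the sharpened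
bound `(K+1) + hK' − C(h,2)`; asymptotically the single cube fails for all `K ≲ h³/6`.

WHAT THIS IS NOT: the door of record `partitionMinorsHitByVP_of_ballGood_cube` (`Kf h ≤ h³`) is NOT refuted (`C(h,3) < h³`:
the count never bites at `K = h³`); the join variant `stub_qjoinSharp` (≤ 2h pieces of `h²` states) is not touched (a join
has `≈ 2h³` affine room); nothing on crux 14610 or VP ≠ VNP.
-/

set_option linter.dupNamespace false

namespace Summit.ValiantsHypothesis.ValiantsHypothesis.Theorems.BarrierLever.HiddenStates

open Finset Matrix

noncomputable section

namespace TripleRank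

/-! ## Two-layer ball–colex threshold families: members are small and their pairs sit on few states -/

section thresholds

variable {K r : ℕ}

/-- A set of at most two states is lighter than `3·2^K`. -/
theorem key_lt_of_card_le_two (J : Finset (Fin K)) (hJ : J.card ≤ 2) : ∑ k ∈ J, ballWt K k < 3 * 2 ^ K := by
  rw [sum_ballWt]
  have h1 := sum_two_pow_lt K J
  have h2 : J.card * 2 ^ K ≤ 2 * 2 ^ K := Nat.mul_le_mul_right _ hJ
  omega

/-- A set of at least three states is at least as heavy as `3·2^K`. -/
theorem key_ge_of_three_le_card (J : Finset (Fin K)) (hJ : 3 ≤ J.card) : 3 * 2 ^ K ≤ ∑ k ∈ J, ballWt K k := by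
  rw [sum_ballWt]
  have : 3 * 2 ^ K ≤ J.card * 2 ^ K := Nat.mul_le_mul_right _ hJ
  omega

/-- **In the two-layer regime every member of a threshold family has at most two states.** If `r ≤ 1 + K + C(K,2)`
and `e : Fin r → Finset (Fin K)` is a threshold family for the ball–colex weight, then `|e k| ≤ 2` for all `k` (the
`1 + K + C(K,2)` sets of size `≤ 2` are all lighter than a set of size `≥ 3`, so they would all be in the range). -/
theorem card_le_two_of_threshold (hr : r ≤ 1 + K + K.choose 2) (e : Fin r → Finset (Fin K))
    (hthr : ∀ J, J ∉ Set.range e → ∀ i, ∑ k ∈ e i, ballWt K k < ∑ k ∈ J, ballWt K k) (k₀ : Fin r) :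
    (e k₀).card ≤ 2 := by
  classical
  by_contra hbig
  push Not at hbig
  -- the light sets: ∅, singletons, pairs
  let L := Option (Fin K) ⊕ ((Finset.univ : Finset (Fin K)).powersetCard 2)
  let f : L → Finset (Fin K) := fun l => match l with
    | Sum.inl none => ∅
    | Sum.inl (some q) => {q}
    | Sum.inr P => (P : Finset (Fin K))
  have hfcard : ∀ l, (f l).card ≤ 2 := by
    rintro ((_ | q) | ⟨P, hP⟩)
    · simp [f]
    · simp [f]
    · simp only [f]
      rw [(Finset.mem_powersetCard.mp hP).2]
  have hf : Function.Injective f := by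
    rintro ((_ | q) | ⟨P, hP⟩) ((_ | q') | ⟨P', hP'⟩) hll <;> simp only [f] at hll
    · rfl
    · exact absurd hll.symm (Finset.singleton_ne_empty q')
    · have := (Finset.mem_powersetCard.mp hP').2
      rw [← hll, Finset.card_empty] at this
      omega
    · exact absurd hll (Finset.singleton_ne_empty q)
    · rw [Finset.singleton_injective hll]
    · have := (Finset.mem_powersetCard.mp hP').2
      rw [← hll, Finset.card_singleton] at this
      omega
    · have := (Finset.mem_powersetCard.mp hP).2
      rw [hll, Finset.card_empty] at this
      omega
    · have := (Finset.mem_powersetCard.mp hP).2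
      rw [hll, Finset.card_singleton] at this
      omega
    · exact congrArg Sum.inr (Subtype.ext hll)
  -- each light set is lighter than `e k₀`, hence in the range
  have hlight : ∀ l, ∑ k ∈ f l, ballWt K k < ∑ k ∈ e k₀, ballWt K k := fun l =>
    lt_of_lt_of_le (key_lt_of_card_le_two _ (hfcard l)) (key_ge_of_three_le_card _ hbig)
  have hrange : ∀ l, f l ∈ Set.range e := by
    intro l
    by_contra hno
    exact absurd (hthr (f l) hno k₀) (not_lt.mpr (hlight l).le)
  choose g hg using hrange
  have hg_inj : Function.Injective g := fun l l' hll' => hf (by rw [← hg l, ← hg l', hll'])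
  have hg_ne : ∀ l, g l ≠ k₀ := by
    intro l hl
    have := hfcard l
    rw [← hg l, hl] at this
    omega
  have hle := Fintype.card_le_of_injective (fun l => (⟨g l, hg_ne l⟩ : {k : Fin r // k ≠ k₀}))
    (fun l l' hll' => hg_inj (congrArg Subtype.val hll'))
  rw [Fintype.card_sum, Fintype.card_option, Fintype.card_fin, Fintype.card_coe, Finset.card_powersetCard,
    Finset.card_univ, Fintype.card_fin, Fintype.card_subtype_compl, Fintype.card_fin,
    Fintype.card_unique] at hle
  omega

/-- The first `K'` states as a `Finset`. -/
abbrev lowStates (K K' : ℕ) (hK' : K' ≤ K) : Finset (Fin K) :=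
  (Finset.univ : Finset (Fin K')).map (Fin.castLEEmb hK')

/-- The first `K'` states number `K'`. -/
theorem card_lowStates (K K' : ℕ) (hK' : K' ≤ K) : (lowStates K K' hK').card = K' := by
  simp [lowStates]

/-- Membership in the first `K'` states is `q < K'`. -/
theorem mem_lowStates {K K' : ℕ} (hK' : K' ≤ K) (q : Fin K) : q ∈ lowStates K K' hK' ↔ (q : ℕ) < K' := by
  constructor
  · intro hq
    obtain ⟨q', -, rfl⟩ := Finset.mem_map.mp hq
    simp
  · intro hq
    exact Finset.mem_map.mpr ⟨⟨q, hq⟩, Finset.mem_univ _, by ext; simp⟩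

/-- The binary part of a set inside the first `K'` states is below `2^{K'}`. -/
theorem sum_two_pow_lt_of_subset {K K' : ℕ} (hK' : K' ≤ K) (J : Finset (Fin K)) (hJ : J ⊆ lowStates K K' hK') :
    ∑ k ∈ J.map Fin.valEmbedding, 2 ^ k < 2 ^ K' :=
  Nat.geomSum_lt (le_refl 2) fun k hk => by
    obtain ⟨k', hk', rfl⟩ := Finset.mem_map.mp hk
    exact (mem_lowStates hK' k').mp (hJ hk')

/-- **In the regime `r ≤ 1 + K + C(K',2)` the two-state members of a threshold family sit inside the first `K'` states**
(binary order: every pair inside the first `K'` states is lighter than a pair touching a later state). -/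
theorem pair_subset_lowStates_of_threshold {K' : ℕ} (hK' : K' ≤ K) (hr : r ≤ 1 + K + K'.choose 2)
    (e : Fin r → Finset (Fin K))
    (hthr : ∀ J, J ∉ Set.range e → ∀ i, ∑ k ∈ e i, ballWt K k < ∑ k ∈ J, ballWt K k) (k₀ : Fin r)
    (h2 : (e k₀).card = 2) : e k₀ ⊆ lowStates K K' hK' := by
  classical
  by_contra hnot
  obtain ⟨q, hq, hqS⟩ := Finset.not_subset.mp hnot
  have hqK' : K' ≤ (q : ℕ) := by
    by_contra hlt
    exact hqS ((mem_lowStates hK' q).mpr (by omega))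
  -- lower bound on the key of `e k₀`: 2·2^K + 2^{K'}
  have hkey₀ : 2 * 2 ^ K + 2 ^ K' ≤ ∑ k ∈ e k₀, ballWt K k := by
    rw [sum_ballWt, h2]
    have hqmem : (q : ℕ) ∈ (e k₀).map Fin.valEmbedding := Finset.mem_map.mpr ⟨q, hq, rfl⟩
    have h1 : 2 ^ (q : ℕ) ≤ ∑ k ∈ (e k₀).map Fin.valEmbedding, 2 ^ k :=
      Finset.single_le_sum (fun _ _ => Nat.zero_le _) hqmem
    have h2' : 2 ^ K' ≤ 2 ^ (q : ℕ) := Nat.pow_le_pow_right (by norm_num) hqK'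
    omega
  -- the light sets: ∅, singletons, pairs inside the first K' states
  let S := lowStates K K' hK'
  let L := Option (Fin K) ⊕ (S.powersetCard 2)
  let f : L → Finset (Fin K) := fun l => match l with
    | Sum.inl none => ∅
    | Sum.inl (some q) => {q}
    | Sum.inr P => (P : Finset (Fin K))
  have hflight : ∀ l, ∑ k ∈ f l, ballWt K k < ∑ k ∈ e k₀, ballWt K k := by
    intro l
    refine lt_of_lt_of_le ?_ hkey₀
    have hj : 1 ≤ 2 ^ K' := Nat.one_le_two_pow
    have hi : 1 ≤ 2 ^ K := Nat.one_le_two_pow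
    rcases l with ((_ | p) | ⟨P, hP⟩)
    · simp only [f, Finset.sum_empty]
      positivity
    · simp only [f]
      rw [sum_ballWt, Finset.card_singleton, one_mul]
      have := sum_two_pow_lt K ({p} : Finset (Fin K))
      omega
    · simp only [f]
      obtain ⟨hPS, hPc⟩ := Finset.mem_powersetCard.mp hP
      rw [sum_ballWt, hPc]
      have := sum_two_pow_lt_of_subset hK' P hPS
      omega
  have hfcard : ∀ l, (f l).card ≤ 2 := by
    rintro ((_ | p) | ⟨P, hP⟩)
    · simp [f]
    · simp [f]
    · simp only [f]; rw [(Finset.mem_powersetCard.mp hP).2]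
  have hf : Function.Injective f := by
    rintro ((_ | p) | ⟨P, hP⟩) ((_ | p') | ⟨P', hP'⟩) hll <;> simp only [f] at hll
    · rfl
    · exact absurd hll.symm (Finset.singleton_ne_empty p')
    · have := (Finset.mem_powersetCard.mp hP').2
      rw [← hll, Finset.card_empty] at this
      omega
    · exact absurd hll (Finset.singleton_ne_empty p)
    · rw [Finset.singleton_injective hll]
    · have := (Finset.mem_powersetCard.mp hP').2
      rw [← hll, Finset.card_singleton] at this
      omega
    · have := (Finset.mem_powersetCard.mp hP).2
      rw [hll, Finset.card_empty] at this
      omega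
    · have := (Finset.mem_powersetCard.mp hP).2
      rw [hll, Finset.card_singleton] at this
      omega
    · exact congrArg Sum.inr (Subtype.ext hll)
  have hrange : ∀ l, f l ∈ Set.range e := by
    intro l
    by_contra hno
    exact absurd (hthr (f l) hno k₀) (not_lt.mpr (hflight l).le)
  choose g hg using hrange
  have hg_inj : Function.Injective g := fun l l' hll' => hf (by rw [← hg l, ← hg l', hll'])
  have hg_ne : ∀ l, g l ≠ k₀ := by
    intro l hl
    have := hflight l
    rw [← hg l, hl] at this
    exact lt_irrefl _ this
  have hle := Fintype.card_le_of_injective (fun l => (⟨g l, hg_ne l⟩ : {k : Fin r // k ≠ k₀}))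
    (fun l l' hll' => hg_inj (congrArg Subtype.val hll'))
  rw [Fintype.card_sum, Fintype.card_option, Fintype.card_fin, Fintype.card_coe, Finset.card_powersetCard,
    card_lowStates, Fintype.card_subtype_compl, Fintype.card_fin, Fintype.card_unique] at hle
  omega

end thresholds

/-! ## The 2-skeleton witness: all triples of `Fin (8m)` against the single cube with `K = h·h` states -/

section witness

/-- The family of all 3-subsets of `Fin h`, enumerated by `Fin (C(h,3))`. -/
def tripleU (h : ℕ) : Fin (((Finset.univ : Finset (Fin h)).powersetCard 3).card) → Finset (Fin h) :=
  fun i => ((((Finset.univ : Finset (Fin h)).powersetCard 3).equivFin.symm i) : Finset (Fin h))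

/-- There are `C(h,3)` triples. -/
theorem card_powersetCard_three (h : ℕ) : ((Finset.univ : Finset (Fin h)).powersetCard 3).card = h.choose 3 := by
  rw [Finset.card_powersetCard, Finset.card_univ, Fintype.card_fin]

/-- The triple enumeration is injective. -/
theorem tripleU_injective (h : ℕ) : Function.Injective (tripleU h) := by
  intro i j hij
  unfold tripleU at hij
  exact ((Finset.univ : Finset (Fin h)).powersetCard 3).equivFin.symm.injective (Subtype.ext hij)

/-- Every enumerated triple has three elements. -/
theorem card_tripleU (h : ℕ) (i) : (tripleU h i).card = 3 := by
  have hmem := (((Finset.univ : Finset (Fin h)).powersetCard 3).equivFin.symm i).2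
  exact (Finset.mem_powersetCard.mp hmem).2

/-- `6·C(N+2, 3) = (N+2)(N+1)N`. -/
theorem six_mul_choose_three (N : ℕ) : 6 * (N + 2).choose 3 = (N + 2) * (N + 1) * N := by
  have h1 : (N + 2) * (N + 1).choose 2 = (N + 2).choose 3 * 3 := Nat.add_one_mul_choose_eq (N + 1) 2
  have h2 : (N + 1) * N.choose 1 = (N + 1).choose 2 * 2 := Nat.add_one_mul_choose_eq N 1
  rw [Nat.choose_one_right] at h2
  nlinarith [h1, h2]

/-- `2·C(N+1, 2) = (N+1)N`. -/
theorem two_mul_choose_two (N : ℕ) : 2 * (N + 1).choose 2 = (N + 1) * N := by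
  have h2 : (N + 1) * N.choose 1 = (N + 1).choose 2 * 2 := Nat.add_one_mul_choose_eq N 1
  rw [Nat.choose_one_right] at h2
  omega

/-- **The 2-skeleton defeats the single cube with `K = h²` states** (`h = 8m`, `m ≥ 5`): the family of all triples of
`Fin (8m)` is NOT `BallGood (8m) ((8m)·(8m)) C(8m,3)`. Proof: the ball–colex family of size `C(8m,3)` on `64m²` states is
two-layer with its pairs inside the first `8m²` states (`C(8m,3) ≤ 1 + 64m² + C(8m²,2)`), and
`(64m² + 1) + 8m²·8m < C(8m,3)` rows of size `3` exceed the triple-row rank bound. -/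
theorem not_ballGood_triples (m : ℕ) (hm : 5 ≤ m) :
    ¬ BallGood (8 * m) (8 * m * (8 * m)) (((Finset.univ : Finset (Fin (8 * m))).powersetCard 3).card)
      (tripleU (8 * m)) := by
  classical
  set h := 8 * m with hh
  set K := h * h with hK
  set r := ((Finset.univ : Finset (Fin h)).powersetCard 3).card with hr
  have hrc : r = h.choose 3 := card_powersetCard_three h
  -- arithmetic
  have h6r : 6 * r = h * (h - 1) * (h - 2) := by
    rw [hrc]
    obtain ⟨N, hN⟩ : ∃ N, h = N + 2 := ⟨h - 2, by omega⟩
    rw [hN, six_mul_choose_three N]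
    simp
  have hK' : 8 * m * m ≤ K := by rw [hK, hh]; nlinarith
  have h2K' : 2 * (8 * m * m).choose 2 = (8 * m * m) * (8 * m * m - 1) := by
    have hpos : 1 ≤ 8 * m * m := by nlinarith
    obtain ⟨N, hN⟩ : ∃ N, 8 * m * m = N + 1 := ⟨8 * m * m - 1, by omega⟩
    rw [hN, two_mul_choose_two N]; simp
  have hKpos : h + 1 ≤ K := by rw [hK, hh]; nlinarith
  have h2K : 2 * K.choose 2 = K * (K - 1) := by
    obtain ⟨N, hN⟩ : ∃ N, K = N + 1 := ⟨K - 1, by omega⟩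
    rw [hN, two_mul_choose_two N]; simp
  have hm1 : 1 ≤ m := by omega
  have hr1 : r ≤ 1 + K + K.choose 2 := by
    -- 6 r = h(h-1)(h-2) ≤ h³ = 512 m³ ≤ 6·C(K,2) for K = 64 m²
    have : 6 * r ≤ 6 * K.choose 2 := by
      rw [h6r]
      have e1 : h * (h - 1) * (h - 2) ≤ h * h * h := by gcongr <;> omega
      have e2 : 3 * (2 * K.choose 2) = 3 * (K * (K - 1)) := by rw [h2K]
      have hK1 : h ≤ K - 1 := by omega
      have e3 : h * h * h ≤ 3 * (K * (K - 1)) := by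
        calc h * h * h = K * h := by rw [hK]
          _ ≤ K * (K - 1) := Nat.mul_le_mul_left _ hK1
          _ ≤ 3 * (K * (K - 1)) := by omega
      omega
    omega
  have hr2 : r ≤ 1 + K + (8 * m * m).choose 2 := by
    have : 6 * r ≤ 6 * (8 * m * m).choose 2 := by
      rw [h6r]
      have e1 : h * (h - 1) * (h - 2) ≤ h * h * h := by gcongr <;> omega
      have h7 : 7 * m * m ≤ 8 * m * m - 1 := by
        have : 7 * m * m + 1 ≤ 8 * m * m := by nlinarith
        omega
      have e4 : (8 * m * m) * (7 * m * m) ≤ (8 * m * m) * (8 * m * m - 1) := Nat.mul_le_mul_left _ h7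
      have e3 : h * h * h ≤ 3 * ((8 * m * m) * (8 * m * m - 1)) := by
        rw [hh]
        nlinarith [e4, hm]
      nlinarith [h2K', e1, e3]
    omega
  have hcount : (K + 1) + (8 * m * m) * h < r := by
    have : 6 * ((K + 1) + (8 * m * m) * h) < 6 * r := by
      rw [h6r, hK, hh]
      have e1 : 8 * m - 1 ≥ 7 * m + 4 := by omega
      have e2 : 8 * m - 2 ≥ 7 * m + 3 := by omega
      have e3 : 8 * m * (8 * m - 1) * (8 * m - 2) ≥ 8 * m * (7 * m + 4) * (7 * m + 3) := by gcongr
      nlinarith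
    omega
  -- the argument
  intro hgood
  have hrK : r ≤ 2 ^ K := by
    rw [hrc]
    exact (Nat.choose_le_two_pow h 3).trans (Nat.pow_le_pow_right (by norm_num) (by rw [hK]; nlinarith))
  obtain ⟨e, he, hthr⟩ := exists_ballColex K r hrK
  obtain ⟨tx, htx⟩ := hgood e he hthr
  apply htx
  have he2 : ∀ k, (e k).card ≤ 2 := fun k => card_le_two_of_threshold hr1 e hthr k
  have heS : ∀ k, (e k).card = 2 → e k ⊆ lowStates K (8 * m * m) hK' := fun k hk =>
    pair_subset_lowStates_of_threshold hK' hr2 e hthr k hk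
  refine det_eq_zero_of_many_small_rows (tripleU h) e (lowStates K (8 * m * m) hK') he2 heS ?_ tx
  rw [card_lowStates]
  have hall : Fintype.card {i : Fin r // (tripleU h i).card ≤ 3} = r := by
    rw [Fintype.card_subtype, Finset.filter_true_of_mem (fun i _ => (card_tripleU h i).le), Finset.card_univ,
      Fintype.card_fin]
  rw [hall]
  exact hcount

/-- **The sharp single-cube variant Q\*(h²) is unsatisfiable.** There is no `h₁` from which on every injective family of
subsets of `Fin h` is `BallGood h (h·h) r`: for every `h = 8m`, `m ≥ 5`, the family of all triples is a counterexample.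
Consequently the hypothesis of the landed door `partitionMinorsHitByVP_of_ballGood'` cannot be met with `Kf h = h·h`
(the door of record `partitionMinorsHitByVP_of_ballGood_cube`, `Kf h ≤ h³`, is not touched: `C(h,3) < h³`). -/
theorem not_ballGood_sq_hypothesis :
    ¬ ∃ h₁ : ℕ, ∀ h : ℕ, h₁ ≤ h → ∀ (r : ℕ) (u : Fin r → Finset (Fin h)), Function.Injective u →
      BallGood h (h * h) r u := by
  rintro ⟨h₁, H⟩
  have hle : h₁ ≤ 8 * max 5 h₁ := le_trans (le_max_right 5 h₁) (by omega)
  exact not_ballGood_triples (max 5 h₁) (le_max_left _ _)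
    (H (8 * max 5 h₁) hle _ (tripleU (8 * max 5 h₁)) (tripleU_injective _))

end witness

end TripleRank

end

end Summit.ValiantsHypothesis.ValiantsHypothesis.Theorems.BarrierLever.HiddenStates
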